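import Literature.Probability.LatticeModels.DartPhase
import Literature.Probability.LatticeModels.DirichletGreenFunction
import Literature.Probability.RandomPlanarGeometry.PlanarDomains
import Summits.CriticalPhenomena.CardyFormulaZ2.Theorems.CardySusyWardParafermionPrecompactKenyonDefs
import Literature.Probability.LatticeModels.MedialExplorationChains
import Literature.Probability.LatticeModels.MedialWinding

/-!
# The four-dart split of the vertex passage sum (helper for stub `stub_dartDictionary`)

Line `kenyon-stream-second-relation` of the crux `ParafermionPrecompact` (route `CardySusyWard`,
item stmt-CriticalPhenomena-11293). PATHWISE identity behind part (a) of the dart dictionary: for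
every discrete Dobrushin datum `E`, mesh `δ ≠ 0`, configuration `ω` and genuine medial vertex
`z = s(x, x + eᵢ)` that is not an `A`–`B` edge of `E`,
`2 cos(π/12) · passageSum γ δ (1/3) z = Σ_{q : Fin 4} dartPhaseSum γ δ (1/3) c_q`,
`γ = medialExploration E ω`, `c_q = (pivotOf x i q, pivotOf x i q + classOffset q)` the class-`q`
corner at `z` (`fourDart_split_medialExploration`; vocabulary of `…KenyonDefs`) — the lattice
content of "the vertex observable is `κ Σ` of the edge observables at the four adjacent medial
edges" (Smirnov 2010, §2.2; Duminil-Copin–Smirnov 2012, §8.3.1). Proof: `γ` is `[]` or an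
exploration path (`medialExploration_eq_nil_or`): its darts are medial darts and its end-vertices
are the `A`–`B` edges, so every passage through `z` is an incoming dart followed by an outgoing
one. A corner is `(v, v + c_q)` (`isCorner_iff_classOffset`), its dart runs along `(δ/2) I^q (I - 1)`;
the darts arriving at / leaving `z` are two explicit class corners each (`corner_of_target_eq_mv`,
`corner_of_source_eq_mv`) and ANY incoming/outgoing pair is a quarter turn (`abs_turning_at_mv`),
so `W_out = W_in ± π/2`, `windingAt = (W_in + W_out)/2` and `2cos(π/12) e^{-(i/3) windingAt} =
e^{-(i/3) W_in} + e^{-(i/3) W_out}` (`split_phase`); regrouping incoming phases by incoming darts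
(shift `k ↦ k - 1`) and outgoing phases by outgoing darts (`sum_passages_in/out`) gives the
identity (`fourDart_split`). Design: no `FermionicObservable` in the import cone (the
`MedialPath.passageSum` / `Parafermion.dartPhaseSum` aliases the crux is written over stay
unambiguous downstream); the direction/class tables are local notations, no new definitions.
References: S. Smirnov, Ann. of Math. 172 (2010), §2.2 [Smirnov2010]; H. Duminil-Copin,
S. Smirnov, Clay Math. Proc. 15 (2012), §8.3 [DuminilCopinSmirnov2012Lattice].
-/

noncomputable section

namespace Summit.CriticalPhenomena.CardyFormulaZ2.Cruxes.ParafermionPrecompact.KenyonStreamSecondRelation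

open _root_.Literature.Probability.LatticeModels
open _root_.Literature.Probability.Percolation (BondConfig)

/-- Local table (notation, not a definition): source-edge direction of a class-`q` corner. -/
local notation "dir" => (![ex 0, ex 1, -ex 0, -ex 1] : Fin 4 → Site 2)
/-- Local table: travel direction `I^q (I - 1)` of a class-`q` dart, up to the factor `δ/2`. -/
local notation "dvec" => (![Complex.I - 1, -1 - Complex.I, 1 - Complex.I, 1 + Complex.I] : Fin 4 → ℂ)
/-- Local table: class of the dart leaving `s(x, x + eᵢ)` from the pivot `x`. -/
local notation "outL" => (![0, 1] : Fin 2 → Fin 4)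
/-- Local table: class of the dart leaving `s(x, x + eᵢ)` from the pivot `x + eᵢ`. -/
local notation "outR" => (![2, 3] : Fin 2 → Fin 4)
/-- Local table: class of the dart arriving at `s(x, x + eᵢ)` with pivot `x`. -/
local notation "inL" => (![3, 0] : Fin 2 → Fin 4)
/-- Local table: class of the dart arriving at `s(x, x + eᵢ)` with pivot `x + eᵢ`. -/
local notation "inR" => (![1, 2] : Fin 2 → Fin 4)

/-- A pair `(v, f)` is a corner iff `f = v + c_q` for one of the four class offsets. [folklore] -/
theorem isCorner_iff_classOffset (v f : Site 2) :
    IsCorner v f ↔ ∃ q : Fin 4, f = v + classOffset q := by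
  constructor
  · intro h
    rcases h 0 with h0 | h0 <;> rcases h 1 with h1 | h1
    · exact ⟨0, Site.ext_two (by simp [classOffset, h0]) (by simp [classOffset, h1])⟩
    · exact ⟨3, Site.ext_two (by simp [classOffset, ex, h0]) (by simp [classOffset, ex]; omega)⟩
    · exact ⟨1, Site.ext_two (by simp [classOffset, ex]; omega) (by simp [classOffset, ex, h1])⟩
    · exact ⟨2, Site.ext_two (by simp [classOffset, ex]; omega) (by simp [classOffset, ex]; omega)⟩
  · rintro ⟨q, rfl⟩ j
    fin_cases q <;> fin_cases j <;> simp [classOffset, ex]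

/-- The corner neighbour in closed form: `v + (2 (f i - v i) + 1) eᵢ`. [folklore] -/
theorem cornerNeighbor_eq (v f : Site 2) (i : Fin 2) :
    cornerNeighbor v f i = v + Pi.single i (2 * (f i - v i) + 1) := by
  funext j
  by_cases h : j = i <;> [(subst h; simp [cornerNeighbor]; ring); simp [cornerNeighbor, h]]

/-- Source edge of the class-`q` corner at `v`: `{v, v + dir q}`. [folklore] -/
theorem cornerSource_classOffset (v : Site 2) (q : Fin 4) :
    cornerSource v (v + classOffset q) = s(v, v + dir q) := by
  fin_cases q <;> simp [cornerSource, cornerEdge, cornerNeighbor_eq, classOffset, ex, Pi.single_neg]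

/-- Target edge of the class-`q` corner at `v`: `{v, v + dir (q + 1)}`. [folklore] -/
theorem cornerTarget_classOffset (v : Site 2) (q : Fin 4) :
    cornerTarget v (v + classOffset q) = s(v, v + dir (q + 1)) := by
  fin_cases q <;> simp [cornerTarget, cornerEdge, cornerNeighbor_eq, classOffset, ex, Pi.single_neg]

/-- **Travel direction.** The class-`q` dart at pivot `v` runs along `(δ/2) · dvec q`. [folklore] -/
theorem medialPoint_target_sub_source (δ : ℝ) (v : Site 2) (q : Fin 4) :
    medialPoint δ (cornerTarget v (v + classOffset q)) -
        medialPoint δ (cornerSource v (v + classOffset q)) = (δ / 2 : ℂ) * dvec q := by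
  rw [cornerTarget_classOffset, cornerSource_classOffset, medialPoint_mk, medialPoint_mk]
  fin_cases q <;> apply Complex.ext <;> simp [meshPoint, Site.toComplex, ex] <;> ring

/-- **Consecutive darts are perpendicular**: if the class-`q` dart at `v` ends where the
class-`q'` dart at `v'` starts and `q' - q` is odd, the three midpoints turn by `±π/2`. [folklore] -/
theorem abs_turning_eq {δ : ℝ} (hδ : δ ≠ 0) {v v' : Site 2} {q q' : Fin 4} (hodd : q' = q + 1 ∨ q' = q + 3)
    (hmeet : cornerTarget v (v + classOffset q) = cornerSource v' (v' + classOffset q')) :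
    |Polyline.turning (medialPoint δ (cornerSource v (v + classOffset q)))
        (medialPoint δ (cornerTarget v (v + classOffset q)))
        (medialPoint δ (cornerTarget v' (v' + classOffset q')))| = Real.pi / 2 := by
  unfold Polyline.turning
  rw [medialPoint_target_sub_source, hmeet, medialPoint_target_sub_source,
    mul_div_mul_left _ _ (show (δ / 2 : ℂ) ≠ 0 by simp [hδ])]
  have hq : dvec q ≠ 0 := fun h => by have h1 := congrArg Complex.re h; fin_cases q <;> simp at h1
  have key : dvec q' = Complex.I * dvec q ∨ dvec q' = -Complex.I * dvec q := by
    rcases hodd with rfl | rfl <;> [left; right] <;> fin_cases q <;> simp <;> ring_nf <;>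
      simp [Complex.I_sq] <;> ring
  rcases key with h | h <;> rw [h, mul_div_assoc, div_self hq, mul_one]
  · rw [Complex.arg_I, abs_of_pos (by positivity)]
  · rw [Complex.arg_neg_I, abs_neg, abs_of_pos (by positivity)]

/-! ### The four corners at the genuine medial vertex `s(x, x + eᵢ)` -/

/-- **The four corners at `s(x, x + eᵢ)`**: the two outgoing darts start, and the two incoming
darts end, at the medial vertex; outgoing targets differ, incoming sources differ. [folklore] -/
theorem corners_at_mv (x : Site 2) (i : Fin 2) :
    (cornerSource x (x + classOffset (outL i)) = mv (x, i) ∧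
      cornerSource (x + ex i) (x + ex i + classOffset (outR i)) = mv (x, i)) ∧
    (cornerTarget x (x + classOffset (inL i)) = mv (x, i) ∧
      cornerTarget (x + ex i) (x + ex i + classOffset (inR i)) = mv (x, i)) ∧
    cornerTarget x (x + classOffset (outL i)) ≠
      cornerTarget (x + ex i) (x + ex i + classOffset (outR i)) ∧
    cornerSource x (x + classOffset (inL i)) ≠
      cornerSource (x + ex i) (x + ex i + classOffset (inR i)) := by
  simp only [cornerSource_classOffset, cornerTarget_classOffset, mv]
  fin_cases i <;> simp [ex, funext_iff, Fin.forall_fin_two]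

/-- `dir` takes the value `eᵢ` only at `outL i` and `-eᵢ` only at `outR i`. [folklore] -/
theorem dir_eq_iff (q : Fin 4) (i : Fin 2) :
    (dir q = ex i ↔ q = outL i) ∧ (dir q = -ex i ↔ q = outR i) := by
  fin_cases q <;> fin_cases i <;> simp [ex, funext_iff, Fin.forall_fin_two]

/-- **The darts leaving `s(x, x + eᵢ)`** are the two listed ones. [folklore] -/
theorem corner_of_source_eq_mv {v f x : Site 2} {i : Fin 2} (hvf : IsCorner v f)
    (h : cornerSource v f = mv (x, i)) :
    (v = x ∧ f = x + classOffset (outL i)) ∨ (v = x + ex i ∧ f = x + ex i + classOffset (outR i)) := by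
  obtain ⟨q, rfl⟩ := (isCorner_iff_classOffset v f).1 hvf
  rw [cornerSource_classOffset, mv, Sym2.eq_iff] at h
  rcases h with ⟨rfl, h⟩ | ⟨rfl, h⟩
  · obtain rfl := (dir_eq_iff q i).1.1 (add_left_cancel h)
    exact Or.inl ⟨rfl, rfl⟩
  · have h' : dir q = -ex i := by
      rw [← sub_eq_zero, ← sub_eq_zero.2 h]; abel
    obtain rfl := (dir_eq_iff q i).2.1 h'
    exact Or.inr ⟨rfl, rfl⟩

/-- **The darts arriving at `s(x, x + eᵢ)`** are the two listed ones. [folklore] -/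
theorem corner_of_target_eq_mv {v f x : Site 2} {i : Fin 2} (hvf : IsCorner v f)
    (h : cornerTarget v f = mv (x, i)) :
    (v = x ∧ f = x + classOffset (inL i)) ∨ (v = x + ex i ∧ f = x + ex i + classOffset (inR i)) := by
  obtain ⟨q, rfl⟩ := (isCorner_iff_classOffset v f).1 hvf
  rw [cornerTarget_classOffset, mv, Sym2.eq_iff] at h
  have hin : ∀ j : Fin 2, (q + 1 = outL j ↔ q = inL j) ∧ (q + 1 = outR j ↔ q = inR j) := by
    intro j; fin_cases q <;> fin_cases j <;> simp
  rcases h with ⟨rfl, h⟩ | ⟨rfl, h⟩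
  · obtain rfl := (hin i).1.1 ((dir_eq_iff (q + 1) i).1.1 (add_left_cancel h))
    exact Or.inl ⟨rfl, rfl⟩
  · have h' : dir (q + 1) = -ex i := by
      rw [← sub_eq_zero, ← sub_eq_zero.2 h]; abel
    obtain rfl := (hin i).2.1 ((dir_eq_iff (q + 1) i).2.1 h')
    exact Or.inr ⟨rfl, rfl⟩

/-- **Every passage through a genuine medial vertex is a quarter turn**: an incoming dart
followed by an outgoing dart at `s(x, x + eᵢ)` turns by `±π/2` (all four combinations). [folklore] -/
theorem abs_turning_at_mv {δ : ℝ} (hδ : δ ≠ 0) {x : Site 2} {i : Fin 2} {v₁ f₁ v₂ f₂ : Site 2}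
    (h₁ : IsCorner v₁ f₁) (ht₁ : cornerTarget v₁ f₁ = mv (x, i)) (h₂ : IsCorner v₂ f₂)
    (hs₂ : cornerSource v₂ f₂ = mv (x, i)) :
    |Polyline.turning (medialPoint δ (cornerSource v₁ f₁)) (medialPoint δ (cornerTarget v₁ f₁))
        (medialPoint δ (cornerTarget v₂ f₂))| = Real.pi / 2 := by
  have hodd : (outL i = inL i + 1 ∨ outL i = inL i + 3) ∧ (outR i = inL i + 1 ∨ outR i = inL i + 3) ∧
      (outL i = inR i + 1 ∨ outL i = inR i + 3) ∧ (outR i = inR i + 1 ∨ outR i = inR i + 3) := by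
    fin_cases i <;> decide
  have hm := ht₁.trans hs₂.symm
  rcases corner_of_target_eq_mv h₁ ht₁ with ⟨rfl, rfl⟩ | ⟨rfl, rfl⟩ <;>
    rcases corner_of_source_eq_mv h₂ hs₂ with ⟨rfl, rfl⟩ | ⟨h, rfl⟩
  · exact abs_turning_eq hδ hodd.1 hm
  · subst h; exact abs_turning_eq hδ hodd.2.1 hm
  · exact abs_turning_eq hδ hodd.2.2.1 hm
  · subst h; exact abs_turning_eq hδ hodd.2.2.2 hm

/-! ### Winding bookkeeping and the phase identity at a passage -/

/-- **One more segment adds one turning angle** (`m + 2 < |pts|`). [folklore] -/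
theorem winding_take_succ (pts : List ℂ) {m : ℕ} (hm : m + 2 < pts.length) :
    Polyline.winding (pts.take (m + 3)) = Polyline.winding (pts.take (m + 2)) +
      Polyline.turning (pts[m]'(by omega)) (pts[m + 1]'(by omega)) (pts[m + 2]'hm) := by
  have h1 := Polyline.winding_take_add_winding_drop pts (m + 1)
  have h2 := Polyline.winding_take_add_winding_drop pts m
  have h4 : pts.drop (m + 1) = pts[m + 1]'(by omega) :: pts[m + 2]'(by omega) :: pts.drop (m + 3) := by
    rw [List.drop_eq_getElem_cons (by omega), List.drop_eq_getElem_cons (by omega)]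
  rw [List.drop_eq_getElem_cons (by omega : m < pts.length), h4, Polyline.winding_cons_cons_cons, ← h4] at h2
  linarith

/-- **Vertex phase versus dart phases**: if `|b - a| = π/2` then
`2 cos(π/12) · e^{-(i/3)(a+b)/2} = e^{-(i/3) a} + e^{-(i/3) b}`. [folklore] -/
theorem split_phase {a b : ℝ} (h : |b - a| = Real.pi / 2) :
    ((2 * Real.cos (Real.pi / 12) : ℝ) : ℂ) *
        Complex.exp (-Complex.I * ((1 / 3 : ℝ) : ℂ) * (((a + b) / 2 : ℝ) : ℂ)) =
      Complex.exp (-Complex.I * ((1 / 3 : ℝ) : ℂ) * (a : ℂ)) +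
        Complex.exp (-Complex.I * ((1 / 3 : ℝ) : ℂ) * (b : ℂ)) := by
  obtain ⟨t, rfl⟩ : ∃ t, b = a + t := ⟨b - a, by ring⟩
  rw [add_sub_cancel_left] at h
  have ht : Real.cos (Real.pi / 12) = Real.cos (t / 6) := by
    rw [← Real.cos_abs (t / 6), abs_div, h, abs_of_pos (by norm_num : (0:ℝ) < 6)]; ring_nf
  have key : (2 * Real.cos (t / 6) : ℂ) * Complex.exp (-((t / 6 : ℝ) : ℂ) * Complex.I) =
      1 + Complex.exp (-(2 * ((t / 6 : ℝ) : ℂ)) * Complex.I) := by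
    rw [Complex.ofReal_cos, Complex.two_cos, add_mul, ← Complex.exp_add, ← Complex.exp_add]
    congr 1
    · rw [← Complex.exp_zero]; congr 1; ring
    · congr 1; ring
  have e1 : Complex.exp (-Complex.I * ((1 / 3 : ℝ) : ℂ) * (((a + (a + t)) / 2 : ℝ) : ℂ)) =
      Complex.exp (-Complex.I * ((1 / 3 : ℝ) : ℂ) * (a : ℂ)) *
        Complex.exp (-((t / 6 : ℝ) : ℂ) * Complex.I) := by rw [← Complex.exp_add]; congr 1; push_cast; ring
  have e2 : Complex.exp (-Complex.I * ((1 / 3 : ℝ) : ℂ) * ((a + t : ℝ) : ℂ)) =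
      Complex.exp (-Complex.I * ((1 / 3 : ℝ) : ℂ) * (a : ℂ)) *
        Complex.exp (-(2 * ((t / 6 : ℝ) : ℂ)) * Complex.I) := by rw [← Complex.exp_add]; congr 1; push_cast; ring
  rw [ht, e1, e2, ← mul_assoc, mul_comm (((2 * Real.cos (t / 6) : ℝ) : ℂ)), mul_assoc]
  push_cast at key ⊢
  rw [key]; ring

/-! ### Regrouping the passages through a medial vertex by darts -/

section Regroup

variable {γ : List MedialVertex} {z : MedialVertex} {c c' : Site 2 × Site 2}

/-- **Outgoing darts.** If all darts of `γ` are medial, `z` is never the last vertex of `γ`, and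
the darts leaving `z` have the target of `c` or of `c'` (corners sourced at `z`, distinct targets),
a sum over the passages through `z` splits over the traversals of `c` and of `c'`. [folklore] -/
theorem sum_passages_out (hs : cornerSource c.1 c.2 = z) (hs' : cornerSource c'.1 c'.2 = z)
    (hne : cornerTarget c.1 c.2 ≠ cornerTarget c'.1 c'.2)
    (hclass : ∀ v f, IsCorner v f → cornerSource v f = z →
      cornerTarget v f = cornerTarget c.1 c.2 ∨ cornerTarget v f = cornerTarget c'.1 c'.2)
    (hdart : ∀ k (hk : k + 1 < γ.length), IsMedialDart (γ[k]'(by omega)) (γ[k + 1]'hk))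
    (hlast : ∀ k (hk : k < γ.length), γ[k]'hk = z → k + 1 < γ.length) (g : ℕ → ℂ) :
    ∑ k ∈ (Finset.range γ.length).filter (fun k => γ[k]? = some z), g k =
      ∑ k ∈ (Finset.range γ.length).filter
          (fun k => γ[k]? = some (cornerSource c.1 c.2) ∧ γ[k + 1]? = some (cornerTarget c.1 c.2)),
          g k +
        ∑ k ∈ (Finset.range γ.length).filter
          (fun k => γ[k]? = some (cornerSource c'.1 c'.2) ∧
            γ[k + 1]? = some (cornerTarget c'.1 c'.2)), g k := by
  rw [hs, hs', ← Finset.sum_filter_add_sum_filter_not _ (fun k => γ[k + 1]? = some (cornerTarget c.1 c.2)),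
    Finset.filter_filter, Finset.filter_filter]
  congr 1
  refine Finset.sum_congr (Finset.filter_congr fun k hk => ?_) fun _ _ => rfl
  rw [Finset.mem_range] at hk
  constructor
  · rintro ⟨hkz, hnot⟩
    refine ⟨hkz, ?_⟩
    obtain ⟨_, hkz'⟩ := List.getElem?_eq_some_iff.1 hkz
    have hk1 := hlast k hk hkz'
    obtain ⟨v, f, hvf, hsv, htv⟩ := hdart k hk1
    rcases hclass v f hvf (hsv.trans hkz') with h | h
    · exact absurd (List.getElem?_eq_some_iff.2 ⟨hk1, htv.symm.trans h⟩) hnot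
    · exact List.getElem?_eq_some_iff.2 ⟨hk1, htv.symm.trans h⟩
  · rintro ⟨hkz, hc'⟩
    exact ⟨hkz, fun hc => hne (Option.some.inj (hc.symm.trans hc'))⟩

/-- **Incoming darts.** If all darts of `γ` are medial, `z` is never the first vertex of `γ`, and
the darts arriving at `z` have the source of `c` or of `c'` (corners targeted at `z`, distinct
sources), a sum over the passages through `z` splits over the traversals of `c` and of `c'`
(the traversal at position `k` arrives at position `k + 1`). [folklore] -/
theorem sum_passages_in (ht : cornerTarget c.1 c.2 = z) (ht' : cornerTarget c'.1 c'.2 = z)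
    (hne : cornerSource c.1 c.2 ≠ cornerSource c'.1 c'.2)
    (hclass : ∀ v f, IsCorner v f → cornerTarget v f = z →
      cornerSource v f = cornerSource c.1 c.2 ∨ cornerSource v f = cornerSource c'.1 c'.2)
    (hdart : ∀ k (hk : k + 1 < γ.length), IsMedialDart (γ[k]'(by omega)) (γ[k + 1]'hk))
    (hhead : ∀ k (hk : k < γ.length), γ[k]'hk = z → k ≠ 0) (g : ℕ → ℂ) :
    ∑ k ∈ (Finset.range γ.length).filter (fun k => γ[k]? = some z), g k =
      ∑ k ∈ (Finset.range γ.length).filter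
          (fun k => γ[k]? = some (cornerSource c.1 c.2) ∧ γ[k + 1]? = some (cornerTarget c.1 c.2)),
          g (k + 1) +
        ∑ k ∈ (Finset.range γ.length).filter
          (fun k => γ[k]? = some (cornerSource c'.1 c'.2) ∧
            γ[k + 1]? = some (cornerTarget c'.1 c'.2)), g (k + 1) := by
  rw [ht, ht']
  have hP : (Finset.range γ.length).filter (fun k => γ[k]? = some z) =
      ((Finset.range γ.length).filter (fun j => γ[j + 1]? = some z)).image (· + 1) := by
    ext k
    simp only [Finset.mem_filter, Finset.mem_range, Finset.mem_image]
    constructor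
    · rintro ⟨hk, hkz⟩
      obtain ⟨_, hkz'⟩ := List.getElem?_eq_some_iff.1 hkz
      obtain ⟨j, rfl⟩ : ∃ j, k = j + 1 := Nat.exists_eq_succ_of_ne_zero (hhead k hk hkz')
      exact ⟨j, ⟨by omega, hkz⟩, rfl⟩
    · rintro ⟨j, ⟨-, hjz⟩, rfl⟩
      exact ⟨(List.getElem?_eq_some_iff.1 hjz).1, hjz⟩
  rw [hP, Finset.sum_image fun _ _ _ _ h => Nat.succ_injective h,
    ← Finset.sum_filter_add_sum_filter_not _ (fun j => γ[j]? = some (cornerSource c.1 c.2)),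
    Finset.filter_filter, Finset.filter_filter]
  congr 1
  · exact Finset.sum_congr (Finset.filter_congr fun j _ => and_comm) fun _ _ => rfl
  · refine Finset.sum_congr (Finset.filter_congr fun j _ => ?_) fun _ _ => rfl
    constructor
    · rintro ⟨hjz, hnot⟩
      obtain ⟨hj1, hjz'⟩ := List.getElem?_eq_some_iff.1 hjz
      obtain ⟨v, f, hvf, hsv, htv⟩ := hdart j hj1
      rcases hclass v f hvf (htv.trans hjz') with h | h
      · exact absurd (List.getElem?_eq_some_iff.2 ⟨by omega, hsv.symm.trans h⟩) hnot
      · exact ⟨List.getElem?_eq_some_iff.2 ⟨by omega, hsv.symm.trans h⟩, hjz⟩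
    · rintro ⟨hc', hjz⟩
      exact ⟨hjz, fun hc => hne (Option.some.inj (hc.symm.trans hc'))⟩

end Regroup

/-! ### The four-dart split -/

/-- The class list at the pivots of `s(x, x + eᵢ)` consists of the two incoming and the two
outgoing corners. [folklore] -/
theorem sum_classes_eq (Φ : Site 2 × Site 2 → ℂ) (x : Site 2) (i : Fin 2) :
    ∑ q : Fin 4, Φ (pivotOf x i q, pivotOf x i q + classOffset q) =
      Φ (x, x + classOffset (inL i)) + Φ (x + ex i, x + ex i + classOffset (inR i)) +
        (Φ (x, x + classOffset (outL i)) + Φ (x + ex i, x + ex i + classOffset (outR i))) := by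
  fin_cases i <;> simp [Fin.sum_univ_four, pivotOf] <;> ring

/-- **FOUR-DART SPLIT (lists).** If all darts of `γ` are medial and the genuine medial vertex
`z = s(x, x + eᵢ)` is neither the first nor the last vertex of `γ`, then `2 cos(π/12)` times the
spin-`1/3` passage sum of `γ` at `z` is the sum of its dart phase sums over the four class corners
at `z`. [folklore] -/
theorem fourDart_split {γ : List MedialVertex} {δ : ℝ} (hδ : δ ≠ 0) (x : Site 2) (i : Fin 2)
    (hdart : ∀ k (hk : k + 1 < γ.length), IsMedialDart (γ[k]'(by omega)) (γ[k + 1]'hk))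
    (hhead : ∀ k (hk : k < γ.length), γ[k]'hk = mv (x, i) → k ≠ 0)
    (hlast : ∀ k (hk : k < γ.length), γ[k]'hk = mv (x, i) → k + 1 < γ.length) :
    ((2 * Real.cos (Real.pi / 12) : ℝ) : ℂ) * MedialPath.passageSum γ δ (1 / 3) (mv (x, i)) =
      ∑ q : Fin 4, Parafermion.dartPhaseSum γ δ (1 / 3)
        (pivotOf x i q, pivotOf x i q + classOffset q) := by
  let e : ℕ → ℂ := fun m => Complex.exp
    (-Complex.I * ((1 / 3 : ℝ) : ℂ) * ((Polyline.winding ((γ.map (medialPoint δ)).take m) : ℝ) : ℂ))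
  have hsplit : ∀ k ∈ (Finset.range γ.length).filter (fun k => γ[k]? = some (mv (x, i))),
      ((2 * Real.cos (Real.pi / 12) : ℝ) : ℂ) *
          Complex.exp (-Complex.I * ((1 / 3 : ℝ) : ℂ) * ((MedialPath.windingAt γ δ k : ℝ) : ℂ)) =
        e (k + 1) + e (k + 2) := by
    intro k hk
    obtain ⟨hk, hkz⟩ := Finset.mem_filter.1 hk
    rw [Finset.mem_range] at hk
    obtain ⟨_, hkz'⟩ := List.getElem?_eq_some_iff.1 hkz
    obtain ⟨m, rfl⟩ : ∃ m, k = m + 1 := Nat.exists_eq_succ_of_ne_zero (hhead k hk hkz')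
    have h2 : m + 2 < γ.length := hlast (m + 1) hk hkz'
    show ((2 * Real.cos (Real.pi / 12) : ℝ) : ℂ) * Complex.exp (-Complex.I * ((1 / 3 : ℝ) : ℂ) *
        (((Polyline.winding ((γ.map (medialPoint δ)).take (m + 2)) +
          Polyline.winding ((γ.map (medialPoint δ)).take (m + 3))) / 2 : ℝ) : ℂ)) = e (m + 2) + e (m + 3)
    apply split_phase
    rw [winding_take_succ (γ.map (medialPoint δ)) (by simpa using h2), add_sub_cancel_left]
    obtain ⟨v₁, f₁, hc₁, hs₁, ht₁⟩ := hdart m (by omega)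
    obtain ⟨v₂, f₂, hc₂, hs₂, ht₂⟩ := hdart (m + 1) h2
    simp only [List.getElem_map]
    rw [← hs₁, ← ht₂, ← ht₁]
    exact abs_turning_at_mv hδ hc₁ (ht₁.trans hkz') hc₂ (hs₂.trans hkz')
  rw [MedialPath.passageSum_eq, Finset.mul_sum, Finset.sum_congr rfl hsplit, Finset.sum_add_distrib]
  obtain ⟨⟨hoL, hoR⟩, ⟨hiL, hiR⟩, hneO, hneI⟩ := corners_at_mv x i
  rw [sum_passages_in (γ := γ) (c := (x, x + classOffset (inL i)))
      (c' := (x + ex i, x + ex i + classOffset (inR i))) hiL hiR hneI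
      (fun v f hvf h => by
        rcases corner_of_target_eq_mv hvf h with ⟨rfl, rfl⟩ | ⟨rfl, rfl⟩ <;> simp)
      hdart hhead (fun k => e (k + 1)),
    sum_passages_out (γ := γ) (c := (x, x + classOffset (outL i)))
      (c' := (x + ex i, x + ex i + classOffset (outR i))) hoL hoR hneO
      (fun v f hvf h => by
        rcases corner_of_source_eq_mv hvf h with ⟨rfl, rfl⟩ | ⟨rfl, rfl⟩ <;> simp)
      hdart hlast (fun k => e (k + 2)), sum_classes_eq]
  rfl

/-- Two consecutive entries of a list form an infix. [folklore] -/
theorem infix_pair_getElem' {α : Type*} (l : List α) (k : ℕ) (h : k + 1 < l.length) :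
    [l[k]'(by omega), l[k + 1]] <:+: l := by
  refine ⟨l.take k, l.drop (k + 2), ?_⟩
  have h1 : l.drop k = l[k]'(by omega) :: l.drop (k + 1) := List.drop_eq_getElem_cons _
  rw [List.append_assoc]
  conv_rhs => rw [← List.take_append_drop k l, h1, List.drop_eq_getElem_cons h]
  rfl

/-- **FOUR-DART SPLIT for the exploration path** (registered helper of `stub_dartDictionary`): for
every datum `E`, mesh `δ ≠ 0`, configuration `ω` and genuine medial vertex `s(x, x + eᵢ)` which is
not an `A`–`B` edge of `E`, `2cos(π/12) · passageSum γ δ (1/3) s(x,x+eᵢ) = Σ_q dartPhaseSum γ δ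
(1/3) (class-q corner)`, `γ = medialExploration E ω` (Smirnov 2010, §2.2; DCS 2012, §8.3.1). [folklore] -/
theorem fourDart_split_medialExploration :
    ∀ (E : DiscreteDobrushin) (δ : ℝ), δ ≠ 0 → ∀ (ω : BondConfig (Site 2)) (x : Site 2) (i : Fin 2),
      mv (x, i) ∉ E.zdABEdges →
        ((2 * Real.cos (Real.pi / 12) : ℝ) : ℂ) *
            MedialPath.passageSum (medialExploration E ω) δ (1 / 3) (mv (x, i)) =
          ∑ q : Fin 4, Parafermion.dartPhaseSum (medialExploration E ω) δ (1 / 3)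
            (pivotOf x i q, pivotOf x i q + classOffset q) := by
  intro E δ hδ ω x i hz
  rcases medialExploration_eq_nil_or E ω with h | h
  · simp [h]
  · refine fourDart_split hδ x i (fun k hk => (h.step _ _ (infix_pair_getElem' _ k hk)).isMedialDart)
      (fun k hk hkz => ?_) (fun k hk hkz => ?_)
    · rintro rfl
      rw [← List.head_eq_getElem h.ne_nil] at hkz
      exact hz (hkz ▸ h.head_mem)
    · by_contra hk1
      obtain rfl : k = (medialExploration E ω).length - 1 := by omega
      rw [← List.getLast_eq_getElem h.ne_nil] at hkz
      exact hz (hkz ▸ h.getLast_mem)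

end Summit.CriticalPhenomena.CardyFormulaZ2.Cruxes.ParafermionPrecompact.KenyonStreamSecondRelation

end
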